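import Summits.QuantumAdvantage.QuantumAdvantage.Theorems.RandomOracleGaugeVarianceAmplification
import Summits.QuantumAdvantage.QuantumAdvantage.Theorems.RandomOracleGaugePromiseTransfer

/-!
# Route `SosSandwich`, crux `PseudoBoundedAA` (stmt-QuantumAdvantage-15237) — reduced to the decoupled core of the AA conjecture

Status theorem for the crux `PseudoBoundedAA` (PB-AA: pseudo-bounded polynomials of order `T` with `Var ≥ ε` have a
variable of influence `≥ C (ε/T)^c`). Its registered line `birth` is dead (`stub_homogeneousRung = HomogeneousPBAA`
refuted, `not_HomogeneousPBAA`; `stub_levelDescent ⟺` the crux, `…RepairedLine`), but the crux is implied by the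
Aaronson–Ambainis conjecture (`pseudoBoundedAA_of_aaConj`), whose filed split
`AAConj ⟸ DecoupledCoreAA ∧ OneBlockDecoupling ∧ VarianceAmplification` (`AAConj_of_subs`) now has BOTH reduction
cruxes proved in the tree (`OneBlockDecoupling_proof`, `VarianceAmplification_proof`; `AAConj_of_decoupledCore`).
Hence:

* **`pseudoBoundedAA_of_decoupledCore`** — `DecoupledCoreAA → PseudoBoundedAA`: the whole open content of
  stmt-QuantumAdvantage-15237 is contained in the single open core `DecoupledCoreAA` (stmt-QuantumAdvantage-17872:
  an `ℓ¹`-bounded family of degree-`d` cube polynomials with total `L²`-mass `≥ 1/poly(d)` has a heavy member or a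
  heavy coordinate, polynomially — registered stub `stub_l1Family` of `Cruxes/AAConj/Lines/l1_family.lean`).

Honest label: a reduction (conditional result); neither the crux nor the core is proved here.
[cite: ODonnellZhao2016, Cor. 2.12 and Thm. 2.13] [cite: AaronsonAmbainis2014, Conj. 6]
-/

-- D-0017: single-conjunct summit ⇒ the duplicate `QuantumAdvantage.QuantumAdvantage` is mandated.
set_option linter.dupNamespace false

namespace Summit.QuantumAdvantage.QuantumAdvantage.Theorems.SosSandwich

/-- **PB-AA from the decoupled core of the Aaronson–Ambainis conjecture**: `DecoupledCoreAA → PseudoBoundedAA`,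
composing `AAConj_of_decoupledCore` (one-block decoupling + variance amplification, both proved) with
`pseudoBoundedAA_of_aaConj`. [cite: ODonnellZhao2016, Thm. 2.13] [cite: AaronsonAmbainis2014, Conj. 6] -/
theorem pseudoBoundedAA_of_decoupledCore
    (hCore : Summit.QuantumAdvantage.QuantumAdvantage.Theses.RandomOracleGauge.DecoupledCoreAA) :
    Summit.QuantumAdvantage.QuantumAdvantage.Theses.SosSandwich.PseudoBoundedAA :=
  Summit.QuantumAdvantage.QuantumAdvantage.Theorems.RandomOracleGauge.pseudoBoundedAA_of_aaConj
    (Summit.QuantumAdvantage.QuantumAdvantage.Theorems.RandomOracleGauge.AAConj_of_decoupledCore hCore)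

end Summit.QuantumAdvantage.QuantumAdvantage.Theorems.SosSandwich
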